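/-
Copyright (c) 2026 the pub-hodgecm-mathlib formalisation cell (harness21).  Prover seat hodgecm-mathlib-A-p03 (g24); LEAD F0P3a-plan (g9) WORD T8-34 (C) «(L3)»,
architect A-p06 (g26) (MAP v2 WANT 2–5), 2026-09-01.
-/
import Literature.NumberTheory.Rogawski1990.UnitOrbitalIntegralInertClosedForms   -- the printed closed forms `phiZero` ∕ `phiOne` ∕ `phiH` ∕ `phiKappa` (this seat)
import HarnessLib

/-!
# Flicker's elementary unit fundamental lemma for `U(3)` at an inert place — THE ALGEBRA (Canad. J. Math. 50 (1998), §6 Theorem 15 from Props. 11, 14)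

Topic `NumberTheory/Rogawski1990` (road «D-N7-inert», letter N7-ns = [Rogawski1990, Prop. 4.9.1 (b)] at the inert places); namespace
`Literature.NumberTheory.Rogawski1990.Flicker1998`.  KERNEL lane: THEOREMS ONLY (no `def` — the closed forms are ★ `UnitOrbitalIntegralInertClosedForms`; no instance, no notation,
no named fact, no `sorry`).  Cell `pub/hodgecm-mathlib`, crux H413 = `stmt-HodgeConjecture-24833`; (L3-A) of the census
`F0/P3a/A-p03/g24/CENSUS-L3-FlickerUnitOrbitalIntegrals.A-p03g24.md` (d034d73f).

THE MATHEMATICS [Flicker1998UnitaryFL].  `E∕F` an unramified quadratic extension of `p`-adic fields (`p ≠ 2`), `q` the residual cardinality of `F`,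
`G = U(2,1; E∕F)`, `K` its standard hyperspecial subgroup (`vol K = 1`), `t₀ = diag(a, b, c)` a regular element of the anisotropic `E`-split torus
`T = (E¹)³`, `N₁ = v(a − b)`, `N₂ = v(c − b)`, `N = v(a − c)` (so the two smallest of `N₁, N₂, N` are equal), `t₁, …, t₄` Flicker's representatives of the
four conjugacy classes in the stable class of `t₀` (Prop. 3 p. 78: `t₁ ∈ T₁ = h⁻¹Th` — torus parity `θ̄ = 0` —, `t₂, t₃, t₄ ∈ T₂ = (hr)⁻¹T hr` — `θ̄ = 1` —,
`t₃`, `t₄` with `(b, c)`, `(a, b)` swapped), `Φ(t) = ∫_{Z(t)∖G} 1_K(g⁻¹ t g) dg` (mass one on the compact `Z(t)`).  Flicker computes (Props. 11, 14, by a double-coset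
decomposition `G = ⊔ H u_m K` and explicit volumes) the CLOSED FORMS
* `Φ(t₁) = φ₀(N₁, N₂, N)` (Prop. 14, p. 94; `θ̄ = 0`) and `Φ(t₂) = φ₁(N₁, N)`, `Φ(t₃) = φ₁(N, N₁)`, `Φ(t₄) = φ₁(N₁, N₂)` (Prop. 11, p. 87; `θ̄ = 1`; p. 95: «`Φ(t₂)`
  depends only on `N₁, N₂, N` … `Φ(t₃) = φ(N, N₂, N₁)`, `Φ(t₄) = φ(N₁, N, N₂)`»),
recorded in ★ `UnitOrbitalIntegralInertClosedForms` as the computable `phiZero`, `phiOne : ℕ → ℕ → … → ℚ` EXACTLY AS PRINTED (floors `[x∕2]` = `Nat` division, parities `δ(2 ∣ n)` = `n % 2 = 0`), and the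
H-side value `Φ^st_{1_{K_H}}(t₀) = (q^N(q+1) − 2)∕(q − 1)` (p. 95, with Mars' lattice proof) as `phiH`.  THEOREM 15 (p. 95) — the unit fundamental lemma
`Δ_{G∕H}(t₀) Φ^κ_{1_K}(t₀) = Φ^st_{1_{K_H}}(t₀)` with `Δ_{G∕H}(t₀) = (−q)^{−N₁−N₂}` and `Φ^κ_{1_K}(t₀) = Φ(t₁) + Φ(t₂) − Φ(t₃) − Φ(t₄)` — is then the PURE
ALGEBRAIC IDENTITY **`flicker_theorem15`**: `φ₀(N₁,N₂,N) + φ₁(N₁,N) − φ₁(N,N₁) − φ₁(N₁,N₂) = (−q)^{N₁+N₂} · φ_H(N)` whenever the two smallest of `N₁, N₂, N`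
are equal, proved here by Flicker's three order cases (pp. 95–96) and the parities — kernel-checked.  It is (a) Flicker's §6 in the tree, and (b) the CONSISTENCY
CERTIFICATE of the cell's transcription of the printed constants of Props. 11∕14 (the orbital-integral VALUES themselves — the lattice counts — are the letter
«(L3-V)», cited not proved; this file asserts nothing about orbital integrals).
* §1 nonvanishing of the printed denominators;
* §2 the three order cases `phiKappa_eq_of_lt` (`N₁ = N₂ < N`), `phiKappa_eq_of_eq_of_le₂` (`N₁ = N ≤ N₂`), `phiKappa_eq_of_eq_of_le₁` (`N₂ = N ≤ N₁`);
* §3 **`flicker_theorem15`** and the transfer-factor form **`flicker_theorem15_div`** (`((−q)^{N₁+N₂})⁻¹ · Φ^κ = φ_H`).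
HONEST LABEL: HC_CM is proved only modulo the printed citations until rung 0 closes; this file is arithmetic and pays no letter by itself.

## References
* [Flicker1998UnitaryFL] Y. Z. Flicker, *Elementary proof of the fundamental lemma for a unitary group*, Canad. J. Math. 50 (1998), 74–98: Prop. 3 p. 78, Prop. 11
  p. 87, Prop. 14 p. 94, §6 Theorem 15 pp. 95–96 (and the Remark p. 95 for `Φ^st_{1_{K_H}}`).
* [Rogawski1990] J. D. Rogawski, *Automorphic Representations of Unitary Groups in Three Variables*, Ann. of Math. Stud. 123 (1990), §4.9 Prop. 4.9.1 (b) p. 55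
  («the fundamental lemma for U(3) … proved in [BR₁]»).
* [BlasiusRogawski1992FL] D. Blasius, J. D. Rogawski, *Fundamental lemmas for U(3) and related groups*, CRM Montréal (1992), 363–394, §6 Prop. 6.2.1 (the same count).
-/

set_option autoImplicit false

namespace Literature.NumberTheory.Rogawski1990.Flicker1998

/-! ## §1 The printed denominators -/

variable {q : ℕ}

/-- `q > 1 ⇒ q − 1 ≠ 0` in `ℚ`. [cite: Flicker1998UnitaryFL, §6 p. 95] -/
theorem cast_sub_one_ne_zero (hq : 1 < q) : (q : ℚ) - 1 ≠ 0 := by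
  have : (1 : ℚ) < q := by exact_mod_cast hq
  linarith

/-- `q > 1 ⇒ q⁴ − 1 ≠ 0` in `ℚ`. [cite: Flicker1998UnitaryFL, §6 p. 95] -/
theorem cast_pow_four_sub_one_ne_zero (hq : 1 < q) : (q : ℚ) ^ 4 - 1 ≠ 0 := by
  have h1 : (1 : ℚ) < q := by exact_mod_cast hq
  have : (1 : ℚ) < (q : ℚ) ^ 4 := one_lt_pow₀ h1 (by norm_num)
  linarith

/-! ## §2 The three order cases (Flicker pp. 95–96) -/

/-- **Case `N₁ = N₂ < N`** (p. 95–96: «`Φ^κ(t₀)` is the sum of `Φ(t₁)`, `Φ(t₂)` and `−Φ(t₃) − Φ(t₄) = −2(q+1)∕(q⁴−1)(q^{4[(N₁+1)∕2]} − 1)`; this sum is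
`−2q^{2N₁}∕(q−1) + (q+1)∕(q−1) q^{N+2N₁}`»). [cite: Flicker1998UnitaryFL, §6 Theorem 15 pp. 95–96] -/
theorem phiKappa_eq_of_lt (hq : 1 < q) {n N : ℕ} (h : n < N) :
    phiKappa q n n N = (-(q : ℚ)) ^ (n + n) * phiH q N := by
  have h1 := cast_sub_one_ne_zero hq
  have h4 := cast_pow_four_sub_one_ne_zero hq
  simp only [phiKappa, phiZero, phiOne, phiH, if_pos h, if_neg (not_le.2 h), if_pos (le_of_lt h), if_pos le_rfl, max_self]
  -- parities of `n` and `N`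
  obtain ⟨a, rfl | rfl⟩ := Nat.even_or_odd' n <;> obtain ⟨b, rfl | rfl⟩ := Nat.even_or_odd' N
  · -- n = 2a, N = 2b
    have e1 : (2 * b + 2 * a) % 2 = 0 := by omega
    have e2 : (2 * b - 1 - 2 * a) % 2 ≠ 0 := by omega
    have e3 : 2 * a / 2 = a := by omega
    have e4 : (2 * a + 1) / 2 = a := by omega
    rw [if_pos e1, if_neg e2, e3, e4,
      show (-(q : ℚ)) ^ (2 * b + 2 * a) = (q : ℚ) ^ (2 * b + 2 * a) from Even.neg_pow ⟨b + a, by ring⟩ _,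
      show (-(q : ℚ)) ^ (2 * a + 2 * a) = (q : ℚ) ^ (2 * a + 2 * a) from Even.neg_pow ⟨a + a, by ring⟩ _]
    field_simp
    ring
  · -- n = 2a, N = 2b+1
    have e1 : (2 * b + 1 + 2 * a) % 2 ≠ 0 := by omega
    have e2 : (2 * b + 1 - 1 - 2 * a) % 2 = 0 := by omega
    have e3 : 2 * a / 2 = a := by omega
    have e4 : (2 * a + 1) / 2 = a := by omega
    rw [if_neg e1, if_pos e2, e3, e4,
      show (-(q : ℚ)) ^ (2 * b + 1 + 2 * a) = -(q : ℚ) ^ (2 * b + 1 + 2 * a) from Odd.neg_pow ⟨b + a, by ring⟩ _,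
      show (-(q : ℚ)) ^ (2 * a + 2 * a) = (q : ℚ) ^ (2 * a + 2 * a) from Even.neg_pow ⟨a + a, by ring⟩ _]
    field_simp
    ring
  · -- n = 2a+1, N = 2b
    have e1 : (2 * b + (2 * a + 1)) % 2 ≠ 0 := by omega
    have e2 : (2 * b - 1 - (2 * a + 1)) % 2 = 0 := by omega
    have e3 : (2 * a + 1) / 2 = a := by omega
    have e4 : (2 * a + 1 + 1) / 2 = a + 1 := by omega
    rw [if_neg e1, if_pos e2, e3, e4,
      show (-(q : ℚ)) ^ (2 * b + (2 * a + 1)) = -(q : ℚ) ^ (2 * b + (2 * a + 1)) from Odd.neg_pow ⟨b + a, by ring⟩ _,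
      show (-(q : ℚ)) ^ (2 * a + 1 + (2 * a + 1)) = (q : ℚ) ^ (2 * a + 1 + (2 * a + 1)) from Even.neg_pow ⟨2 * a + 1, by ring⟩ _]
    field_simp
    ring
  · -- n = 2a+1, N = 2b+1
    have e1 : (2 * b + 1 + (2 * a + 1)) % 2 = 0 := by omega
    have e2 : (2 * b + 1 - 1 - (2 * a + 1)) % 2 ≠ 0 := by omega
    have e3 : (2 * a + 1) / 2 = a := by omega
    have e4 : (2 * a + 1 + 1) / 2 = a + 1 := by omega
    rw [if_pos e1, if_neg e2, e3, e4,
      show (-(q : ℚ)) ^ (2 * b + 1 + (2 * a + 1)) = (q : ℚ) ^ (2 * b + 1 + (2 * a + 1)) from Even.neg_pow ⟨b + a + 1, by ring⟩ _,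
      show (-(q : ℚ)) ^ (2 * a + 1 + (2 * a + 1)) = (q : ℚ) ^ (2 * a + 1 + (2 * a + 1)) from Even.neg_pow ⟨2 * a + 1, by ring⟩ _]
    field_simp
    ring

/-- **Case `N₁ = N ≤ N₂`** (p. 95: «`Φ(t₂) = Φ(t₃)`, hence `Φ^κ(t₀) = Φ(t₁) − Φ(t₄)`, and this difference is
`−2(−q)^{N₁+N₂}∕(q−1) + (δ(2 ∣ N₂−N₁) − δ(2 ∣ N₂−1−N₁))(q+1)∕(q−1) q^{N₂+2N₁}`»). [cite: Flicker1998UnitaryFL, §6 Theorem 15 p. 95] -/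
theorem phiKappa_eq_of_eq_of_le₂ (hq : 1 < q) {n N₂ : ℕ} (h : n ≤ N₂) :
    phiKappa q n N₂ n = (-(q : ℚ)) ^ (n + N₂) * phiH q n := by
  have h1 := cast_sub_one_ne_zero hq
  rcases h.eq_or_lt with rfl | hlt
  · -- all three equal
    simp only [phiKappa, phiZero, phiOne, phiH, lt_irrefl, if_false, if_pos le_rfl, max_self, Nat.sub_self, Nat.zero_mod, if_true]
    obtain ⟨a, rfl | rfl⟩ := Nat.even_or_odd' n
    · have e3 : 2 * a / 2 = a := by omega
      have e4 : (2 * a + 1) / 2 = a := by omega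
      rw [e3, e4, show (-(q : ℚ)) ^ (2 * a + 2 * a) = (q : ℚ) ^ (2 * a + 2 * a) from Even.neg_pow ⟨a + a, by ring⟩ _]
      have h4 := cast_pow_four_sub_one_ne_zero hq
      field_simp
      ring
    · have e3 : (2 * a + 1) / 2 = a := by omega
      have e4 : (2 * a + 1 + 1) / 2 = a + 1 := by omega
      rw [e3, e4, show (-(q : ℚ)) ^ (2 * a + 1 + (2 * a + 1)) = (q : ℚ) ^ (2 * a + 1 + (2 * a + 1)) from Even.neg_pow ⟨2 * a + 1, by ring⟩ _]
      have h4 := cast_pow_four_sub_one_ne_zero hq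
      field_simp
      ring
  · simp only [phiKappa, phiZero, phiOne, phiH, lt_irrefl, if_false, if_pos le_rfl, if_neg (not_le.2 hlt), max_eq_right h]
    -- parity of `N₂ - n`
    obtain ⟨d, hd | hd⟩ := Nat.even_or_odd' (N₂ - n)
    · have e1 : (N₂ - n) % 2 = 0 := by omega
      have e2 : (N₂ - 1 - n) % 2 ≠ 0 := by omega
      have hN : N₂ = n + 2 * d := by omega
      subst hN
      rw [if_pos e1, if_neg e2,
        show (-(q : ℚ)) ^ (n + 2 * d + n) = (-(q : ℚ)) ^ (n + (n + 2 * d)) by ring_nf]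
      obtain ⟨a, rfl | rfl⟩ := Nat.even_or_odd' n
      · rw [show (-(q : ℚ)) ^ (2 * a + (2 * a + 2 * d)) = (q : ℚ) ^ (2 * a + (2 * a + 2 * d)) from Even.neg_pow ⟨2 * a + d, by ring⟩ _]
        field_simp
        ring
      · rw [show (-(q : ℚ)) ^ (2 * a + 1 + (2 * a + 1 + 2 * d)) = (q : ℚ) ^ (2 * a + 1 + (2 * a + 1 + 2 * d)) from
          Even.neg_pow ⟨2 * a + 1 + d, by ring⟩ _]
        field_simp
        ring
    · have e1 : (N₂ - n) % 2 ≠ 0 := by omega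
      have e2 : (N₂ - 1 - n) % 2 = 0 := by omega
      have hN : N₂ = n + (2 * d + 1) := by omega
      subst hN
      rw [if_neg e1, if_pos e2,
        show (-(q : ℚ)) ^ (n + (2 * d + 1) + n) = (-(q : ℚ)) ^ (n + (n + (2 * d + 1))) by ring_nf,
        show (-(q : ℚ)) ^ (n + (n + (2 * d + 1))) = -(q : ℚ) ^ (n + (n + (2 * d + 1))) from Odd.neg_pow ⟨n + d, by ring⟩ _]
      field_simp
      ring

/-- **Case `N₂ = N ≤ N₁`** (p. 95: «`Φ(t₂) = Φ(t₄)`, hence `Φ^κ(t₀) = Φ(t₁) − Φ(t₃)`», the symmetric computation). [cite: Flicker1998UnitaryFL, §6 Theorem 15 p. 95] -/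
theorem phiKappa_eq_of_eq_of_le₁ (hq : 1 < q) {n N₁ : ℕ} (h : n ≤ N₁) :
    phiKappa q N₁ n n = (-(q : ℚ)) ^ (N₁ + n) * phiH q n := by
  have h1 := cast_sub_one_ne_zero hq
  rcases h.eq_or_lt with rfl | hlt
  · simpa only [add_comm] using phiKappa_eq_of_eq_of_le₂ hq (le_refl n)
  · simp only [phiKappa, phiZero, phiOne, phiH, if_neg (not_lt.2 h), if_pos h, if_neg (not_le.2 hlt), max_eq_left h]
    obtain ⟨d, hd | hd⟩ := Nat.even_or_odd' (N₁ - n)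
    · have e1 : (N₁ - n) % 2 = 0 := by omega
      have e2 : (N₁ - 1 - n) % 2 ≠ 0 := by omega
      have hN : N₁ = n + 2 * d := by omega
      subst hN
      rw [if_pos e1, if_neg e2]
      obtain ⟨a, rfl | rfl⟩ := Nat.even_or_odd' n
      · rw [show (-(q : ℚ)) ^ (2 * a + 2 * d + 2 * a) = (q : ℚ) ^ (2 * a + 2 * d + 2 * a) from Even.neg_pow ⟨2 * a + d, by ring⟩ _]
        field_simp
        ring
      · rw [show (-(q : ℚ)) ^ (2 * a + 1 + 2 * d + (2 * a + 1)) = (q : ℚ) ^ (2 * a + 1 + 2 * d + (2 * a + 1)) from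
          Even.neg_pow ⟨2 * a + 1 + d, by ring⟩ _]
        field_simp
        ring
    · have e1 : (N₁ - n) % 2 ≠ 0 := by omega
      have e2 : (N₁ - 1 - n) % 2 = 0 := by omega
      have hN : N₁ = n + (2 * d + 1) := by omega
      subst hN
      rw [if_neg e1, if_pos e2,
        show (-(q : ℚ)) ^ (n + (2 * d + 1) + n) = -(q : ℚ) ^ (n + (2 * d + 1) + n) from Odd.neg_pow ⟨n + d, by ring⟩ _]
      field_simp
      ring

/-! ## §3 Theorem 15 -/

/-- **FLICKER'S THEOREM 15 (the unit fundamental lemma for `U(3)` at an inert place, algebraic form)**: whenever the two smallest of `N₁, N₂, N` are equal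
(the ultrametric constraint on `v(a−b), v(c−b), v(a−c)`), the `κ`-combination of the printed closed forms is `(−q)^{N₁+N₂}` times the H-side value:
`φ₀(N₁,N₂,N) + φ₁(N₁,N) − φ₁(N,N₁) − φ₁(N₁,N₂) = (−q)^{N₁+N₂} · (q^N(q+1) − 2)∕(q−1)`. [cite: Flicker1998UnitaryFL, §6 Theorem 15 pp. 95–96] -/
theorem flicker_theorem15 (hq : 1 < q) {N₁ N₂ N : ℕ}
    (h : (N₁ = N₂ ∧ N₁ ≤ N) ∨ (N₁ = N ∧ N₁ ≤ N₂) ∨ (N₂ = N ∧ N₂ ≤ N₁)) :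
    phiKappa q N₁ N₂ N = (-(q : ℚ)) ^ (N₁ + N₂) * phiH q N := by
  rcases h with ⟨rfl, hle⟩ | ⟨rfl, hle⟩ | ⟨rfl, hle⟩
  · rcases hle.eq_or_lt with rfl | hlt
    · exact phiKappa_eq_of_eq_of_le₂ hq le_rfl
    · exact phiKappa_eq_of_lt hq hlt
  · exact phiKappa_eq_of_eq_of_le₂ hq hle
  · exact phiKappa_eq_of_eq_of_le₁ hq hle

/-- **THEOREM 15 in transfer-factor form**: `Δ_{G∕H}(t₀)·Φ^κ_{1_K}(t₀) = Φ^st_{1_{K_H}}(t₀)` with `Δ_{G∕H}(t₀) = (−q)^{−N₁−N₂}`, read on the closed forms.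
[cite: Flicker1998UnitaryFL, §6 Theorem 15 p. 95] -/
theorem flicker_theorem15_div (hq : 1 < q) {N₁ N₂ N : ℕ}
    (h : (N₁ = N₂ ∧ N₁ ≤ N) ∨ (N₁ = N ∧ N₁ ≤ N₂) ∨ (N₂ = N ∧ N₂ ≤ N₁)) :
    ((-(q : ℚ)) ^ (N₁ + N₂))⁻¹ * phiKappa q N₁ N₂ N = phiH q N := by
  have hq0 : (-(q : ℚ)) ^ (N₁ + N₂) ≠ 0 := pow_ne_zero _ (neg_ne_zero.2 (by exact_mod_cast (by omega : q ≠ 0)))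
  rw [flicker_theorem15 hq h, ← mul_assoc, inv_mul_cancel₀ hq0, one_mul]

end Literature.NumberTheory.Rogawski1990.Flicker1998
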